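import Summits.QuantumFields.BalabanUV.Beta.D1BFx.GluonLeg
import Literature.MathematicalPhysics.QuantumFieldTheory.Balaban1983to89.Beta.HessKerRate

/-!
# `BalabanUV.Beta.D1BFx.ReducedKernel` — road «BF-x» for binder row D1, typer object T8: THE DRESSED REDUCED ONE-SHOT KERNEL
# `TOfRed n a S W := hessKer (Ga n a) (vertexRed n S) W` — EXACTLY the shape of `OneStepResolventKernel.TOf` with the bordered
# resolvent `KInv n` replaced by the reduced gluon leg `Ga n a` (T1) on the fibre `Fin 4`, the chain-rule vertex dressed by the SAME
# minimiser response `KernelSpecInstance.wH`; vertex-family, covariance and — under the honest decay binder on `Ga` — the (5.10)-shape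
# decay and second-moment bound with the EXPLICIT constant `hessConst`, generic in the reduced jet data `(S, W)`

HONEST FRAMING (cell contract, verbatim): «discharging `BetaPertH` makes Bałaban's UV stability UNCONDITIONAL — a real constructive-QFT
result; it is NOT the continuum limit and NOT the Clay problem.»  HONEST DEPENDENCY (verbatim): «continuum YM on T⁴ ⇐ BetaPertH ∧ nine
spine estimates (0/9 proved); BetaPertH ⇐ (D1) ∧ (D4) ∧ CAP+tail; G-an2-4 gates asym, D1 and NE2/3/4.»  THIS MODULE DISCHARGES NOTHING.
Two definitions with bodies (the reduced twins of `OneStepResolventKernel.vertexOf` / `TOf`, VERBATIM bodies on the fibre `Fin 4` with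
`KInv ↦ Ga`) and [folklore] kernel bookkeeping composed BY NAME from the tree (`OneStepResolventKernel.biLoc_wsum` / `biLoc_finset_sum` /
`wsum_shift`, `KernelSpecInstance.decay_wH`, `ExpKernelCalculus.hess_eq_hessKer` / `absMoment₂_hessKer`, `HessKerRate.decay510_hessKer_explicit`,
`B12Sec2to5.secondMoment_abs_le_of_decay510`, T1's `D1BFx.GluonLeg.blockCovariant_Ga`).  No `Prop` is minted; nothing printed is asserted;
0 sorry.  NOT summit progress; NOT BetaPertH, NOT continuum, NOT Clay.

ABSOLUTE RULE (cell, verbatim): «No internally-minted statement may enter as a cited fact. Every hypothesis is either kernel-proved in this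
package or a verbatim quotation of a PUBLISHED theorem with page reference. The manuscript(s) under audit are NOT citable for their own
disputed steps — they are the thing under adjudication; programme-internal (2001/route/tribunal) claims are never citable.»

WHY (skeleton `HOME/beta/skeletons/D1-b2b-balaban-beta-d1-p2.md` v1.4 nodes O/R/A, typer spec `TYPER-SPEC-D1BFx.md` §1 T8, claim table
`LEAVES-BFx.md` row T8).  K-R2 rewrites the one-shot kernel `hessKer (KInv n) (vertexOf S) W` of the cell as «bubble/tadpole over the REDUCED
gluon leg `Ga` with the field blocks of the stencils» + explicit block-structured terms; K-R1 adds the ghost kernel.  The first summand is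
THIS file's `TOfRed n a Sbf Wbf` once T4/T5 deliver the reduced stencils `Sbf`/`Wbf` — so the object is typed HERE ONCE, generic in
`(S, W)`, with the structure every A-leaf uses: (i) the dressed vertex `vertexRed n S` is a `VertexFamily` at the coarse bonds for any
self-localised stencil family (constants explicit), (ii) block covariance ⇒ the base point `0` represents every base point, (iii) GIVEN
the decay binder `Decays (Ga n a) C δ` — which T1's header records as NOT in the tree (B5 Prop. 1.2 content) and which therefore stays an
explicit hypothesis — every channel of `TOfRed` obeys the (5.10)-shape bound with `HessKerRate.hessConst 4 4 δ C Cv Cw`, a function of the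
decay data ONLY, and its (1.22)-moment is bounded by `betaPrime510 4 (hessConst …) (δ/4)`: uniform along any `n`-family with uniform data.
The identification `TbalOf n (JsBalAn1Ctr …) 0 = TOfRed n a Sbf Wbf + ghostKer + blockTerms` is K-R1/K-R2's theorem and is NOT asserted here.

CONTENT (all [folklore] / [our object]).
* §1 `StencilR`/`TableR` (type abbreviations), `vertexRed`, `vertexRed_apply`, `TOfRed`, `TOfRed_eq`.
* §2 `vertexFamily_vertexRed` (explicit: constant `4·(Cw·Cs·Zl 4 (δ/2))`, rate `δ/2`), `vertexFamily_vertexRed'` (∃-packaged, `decay_wH`),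
  `vertexRed_translate` (`BlockCovariant.covV` for fine-translation-covariant stencils).
* §3 `blockCovariant_TOfRed`, `hess_Ga_eq_TOfRed` (base point).
* §4 under `(hGa : Decays (Ga n a) C δ)`: `decay510_TOfRed`, `abs_secondMoment_TOfRed_le`, `summable_secondMoment_TOfRed`, `absMoment₂_TOfRed`.
-/

noncomputable section

namespace Summit.QuantumFields.BalabanUV.Beta.D1BFx.ReducedKernel

open Finset
open Literature.MathematicalPhysics.QuantumFieldTheory.Balaban1983to89
open Literature.MathematicalPhysics.QuantumFieldTheory.Balaban1983to89.Beta
open B12Sec2to5 (l1 l1_nonneg Decay510 betaPrime510 secondMoment_abs_le_of_decay510)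
open ExpKernelCalculus (Site MKer Decays BiLoc VertexFamily VertexFamily₂ shiftK BlockCovariant hess hessKer hess_eq_hessKer Zl
  absMoment₂_hessKer)
open DecimatedMomentSummable (AbsMoment₂)
open KernelSpecInstance (wH decay_wH)
open OneStepResolventKernel (wsum biLoc_wsum biLoc_finset_sum wsum_shift bound_mono decays_mono biLoc_mono)
open HessKerRate (hessConst decay510_hessKer_explicit)
open Summit.QuantumFields.BalabanUV.Beta.D1BFx.GluonLeg (Ga blockCovariant_Ga)

/-! ## §1 The objects -/

/-- [our object] The type of a REDUCED first-order stencil family: `S κ′ u : MKer 4 (Fin 4)` (field legs only; T4's `Sbf n …` is one). -/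
abbrev StencilR : Type := Fin 4 → Site 4 → MKer 4 (Fin 4)

/-- [our object] The type of a REDUCED second-order table family: `W μ y ν y′ : MKer 4 (Fin 4)` (T5's dressed `Wbf` is one). -/
abbrev TableR : Type := Fin 4 → Site 4 → Fin 4 → Site 4 → MKer 4 (Fin 4)

/-- [our object] **THE REDUCED CHAIN-RULE VERTEX** at the coarse bond `(μ, y)` (blocking `n`): `Σ_{κ′} Σ'_u ℋ_{(κ′,u),(μ,y)} · S κ′ u` with the
minimiser response `ℋ_{(κ′,u),(μ,y)} = wH κ′ μ (u − n•y)` of the cell's `U = 1` system — VERBATIM the body of `OneStepResolventKernel.vertexOf`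
on the fibre `Fin 4` (TYPER-SPEC T8: the reduced and bordered minimisers coincide, so the ℋ-column is the same).  A DEFINITION. -/
def vertexRed (n : ℕ) [NeZero n] (S : StencilR) (μ : Fin 4) (y : Site 4) : MKer 4 (Fin 4) :=
  fun x z a b => ∑ κ' : Fin 4, wsum (fun u => wH (N := n) (d := 3) κ' μ (u - (n : ℤ) • y)) (S κ') x z a b

/-- [our object] **T8 — THE DRESSED REDUCED ONE-SHOT KERNEL**: `TOfRed n a S W := hessKer (Ga n a) (vertexRed n S) W`
(`= ½·tadpole (Ga) (W μ 0 ν z) − ½·bubble (Ga) (vertexRed S μ 0) (vertexRed S ν z)`), the shape of `OneStepResolventKernel.TOf` with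
`KInv n ↦ Ga n a`.  A DEFINITION; asserts nothing (its identification with a piece of the wall's one-shot kernel is K-R1/K-R2's). -/
def TOfRed (n : ℕ) [NeZero n] (a : ℝ) (S : StencilR) (W : TableR) : Fin 4 → Fin 4 → Site 4 → ℝ :=
  hessKer (Ga n a) (vertexRed n S) W

variable (n : ℕ) [NeZero n] (a : ℝ)

/-- [our object] Unfolding `vertexRed`. -/
theorem vertexRed_apply (S : StencilR) (μ : Fin 4) (y : Site 4) (x z : Site 4) (a' b : Fin 4) :
    vertexRed n S μ y x z a' b = ∑ κ' : Fin 4, wsum (fun u => wH (N := n) (d := 3) κ' μ (u - (n : ℤ) • y)) (S κ') x z a' b := rfl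

/-- [our object] Unfolding `TOfRed`. -/
theorem TOfRed_eq (S : StencilR) (W : TableR) : TOfRed n a S W = hessKer (Ga n a) (vertexRed n S) W := rfl

/-! ## §2 The reduced chain-rule vertex: localisation and covariance -/

/-- [folklore] **THE REDUCED CHAIN-RULE VERTEX IS A VERTEX FAMILY** (explicit constants): for a stencil family self-localised at its own
bond with rate `δ` (`∀ κ′ u, BiLoc (S κ′ u) u u Cs δ`) and `δ ≤` the decay rate of `wH`, `vertexRed n S` is bi-localised at the coarse bonds
with constant `4·(Cw·Cs·Zl 4 (δ/2))` and rate `δ/2` (the proof of `OneStepResolventKernel.vertexFamily_vertexOf`, on the fibre `Fin 4`). -/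
theorem vertexFamily_vertexRed {S : StencilR} {Cs δ : ℝ} (hS : ∀ κ' u, BiLoc (S κ' u) u u Cs δ) (hδ : 0 < δ) {Cw δw : ℝ}
    (hCw : 0 ≤ Cw) (hδw : δ ≤ δw) (hwH : ∀ κ l : Fin 4, Decay510 (wH (N := n) (d := 3) κ l) Cw δw) :
    VertexFamily (vertexRed n S) n ((4 : ℕ) * (Cw * Cs * Zl 4 (δ / 2))) (δ / 2) := by
  intro μ y
  have hterm : ∀ κ' : Fin 4, BiLoc (wsum (fun u => wH (N := n) (d := 3) κ' μ (u - (n : ℤ) • y)) (S κ'))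
      ((n : ℤ) • y) ((n : ℤ) • y) (Cw * Cs * Zl 4 (δ / 2)) (δ / 2) := by
    intro κ'
    refine biLoc_wsum (fun u => ?_) (fun u => hS κ' u) hδ hCw
    exact bound_mono (hwH κ' μ (u - (n : ℤ) • y)) hCw le_rfl hδw (l1_nonneg _)
  have hsum := biLoc_finset_sum (Finset.univ : Finset (Fin 4)) (fun κ' _ => hterm κ')
  simp only [Finset.sum_const, Finset.card_univ, Fintype.card_fin, nsmul_eq_mul] at hsum
  exact hsum

/-- [folklore] The packaged form: SOME constant and rate work (rate of `wH` matched by monotonicity, `KernelSpecInstance.decay_wH`). -/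
theorem vertexFamily_vertexRed' {S : StencilR} {Cs δ : ℝ} (hS : ∀ κ' u, BiLoc (S κ' u) u u Cs δ) (hδ : 0 < δ) :
    ∃ Cv δv : ℝ, 0 < δv ∧ δv ≤ δ ∧ VertexFamily (vertexRed n S) n Cv δv := by
  obtain ⟨δw, Cw, hδw, hwH⟩ := decay_wH (N := n) (d := 3)
  have hCw : 0 ≤ Cw := by
    have h0 := hwH 0 0 0
    simp only [l1, Pi.zero_apply, Int.cast_zero, abs_zero, Finset.sum_const_zero, mul_zero, Real.exp_zero, mul_one] at h0
    exact (abs_nonneg _).trans h0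
  have hCs : 0 ≤ Cs := (hS 0 0).nonneg 0
  have hS' : ∀ κ' u, BiLoc (S κ' u) u u Cs (min δ δw) := fun κ' u => biLoc_mono (hS κ' u) hCs (min_le_left _ _)
  refine ⟨_, _, half_pos (lt_min hδ hδw), ?_, vertexFamily_vertexRed n hS' (lt_min hδ hδw) hCw (min_le_right _ _) hwH⟩
  have := min_le_left δ δw
  linarith [hδ]

/-- [folklore] **COVARIANCE OF THE REDUCED CHAIN-RULE VERTEX** (`BlockCovariant.covV`) for a fine-translation-covariant stencil family
(`S κ′ (u + v) = shiftK (−v) (S κ′ u)`): `vertexRed n S μ (y + t) = shiftK (−(n•t)) (vertexRed n S μ y)`. -/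
theorem vertexRed_translate {S : StencilR} (hS : ∀ (κ' : Fin 4) (u v : Site 4), S κ' (u + v) = shiftK (-v) (S κ' u))
    (μ : Fin 4) (y t : Site 4) : vertexRed n S μ (y + t) = shiftK (-((n : ℤ) • t)) (vertexRed n S μ y) := by
  funext x z a' b
  simp only [vertexRed]
  have h : ∀ κ' : Fin 4, wsum (fun u => wH (N := n) (d := 3) κ' μ (u - (n : ℤ) • (y + t))) (S κ') =
      shiftK (-((n : ℤ) • t)) (wsum (fun u => wH (N := n) (d := 3) κ' μ (u - (n : ℤ) • y)) (S κ')) := by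
    intro κ'
    have hw : (fun u => wH (N := n) (d := 3) κ' μ (u - (n : ℤ) • (y + t))) =
        fun u => (fun u' => wH (N := n) (d := 3) κ' μ (u' - (n : ℤ) • y)) (u - (n : ℤ) • t) := by
      funext u
      simp only [smul_add]
      congr 1
      abel
    rw [hw]
    exact wsum_shift (fun u' => wH (N := n) (d := 3) κ' μ (u' - (n : ℤ) • y)) ((n : ℤ) • t) (fun u => hS κ' u ((n : ℤ) • t))
  simp only [h, shiftK, vertexRed]

/-! ## §3 Block covariance of the reduced data: the base point `0` represents every base point -/

/-- [folklore] `BlockCovariant (Ga n a) (vertexRed n S) W n` for a fine-translation-covariant stencil family and a block-covariant table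
family (`covA` = T1's `shiftK_Ga_neg`, `covV` = `vertexRed_translate`). -/
theorem blockCovariant_TOfRed (hn : 1 ≤ n) {S : StencilR} {W : TableR}
    (hS : ∀ (κ' : Fin 4) (u v : Site 4), S κ' (u + v) = shiftK (-v) (S κ' u))
    (hW : ∀ (μ : Fin 4) (y : Site 4) (ν : Fin 4) (y' t : Site 4), W μ (y + t) ν (y' + t) = shiftK (-((n : ℤ) • t)) (W μ y ν y')) :
    BlockCovariant (Ga n a) (vertexRed n S) W n :=
  blockCovariant_Ga n a hn (fun μ y t => vertexRed_translate n hS μ y t) hW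

/-- [folklore] **THE BASE POINT IS IMMATERIAL**: `hess (Ga n a) (vertexRed n S) W μ y ν y′ = TOfRed n a S W μ ν (y′ − y)`. -/
theorem hess_Ga_eq_TOfRed (hn : 1 ≤ n) {S : StencilR} {W : TableR}
    (hS : ∀ (κ' : Fin 4) (u v : Site 4), S κ' (u + v) = shiftK (-v) (S κ' u))
    (hW : ∀ (μ : Fin 4) (y : Site 4) (ν : Fin 4) (y' t : Site 4), W μ (y + t) ν (y' + t) = shiftK (-((n : ℤ) • t)) (W μ y ν y'))
    (μ : Fin 4) (y : Site 4) (ν : Fin 4) (y' : Site 4) :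
    hess (Ga n a) (vertexRed n S) W μ y ν y' = TOfRed n a S W μ ν (y' - y) :=
  hess_eq_hessKer (blockCovariant_TOfRed n a hn hS hW) μ y ν y'

/-! ## §4 Under the decay binder on `Ga`: (5.10)-shape decay and the second-moment bound with the explicit constant -/

section Decay

variable {S : StencilR} {W : TableR} {C Cv Cw δ : ℝ}

/-- [folklore] **(5.10)-SHAPE DECAY OF EVERY CHANNEL OF `TOfRed`, EXPLICIT CONSTANT**: GIVEN `Decays (Ga n a) C δ` (HONEST BINDER — not in
the tree, see `D1BFx/GluonLeg`), a vertex-family bound for `vertexRed n S` and a table-family bound for `W` at the common rate `δ`,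
`|TOfRed n a S W μ ν z| ≤ hessConst 4 4 δ C Cv Cw · e^{−(δ/4)|z|₁}` — the constant is a function of `(δ, C, Cv, Cw)` ONLY
(`HessKerRate.decay510_hessKer_explicit`), hence UNIFORM along any block-size family with uniform data. -/
theorem decay510_TOfRed (hn : 1 ≤ n) (hGa : Decays (Ga n a) C δ) (hV : VertexFamily (vertexRed n S) n Cv δ)
    (hW : VertexFamily₂ W n Cw δ) (hδ : 0 < δ) (μ ν : Fin 4) :
    Decay510 (TOfRed n a S W μ ν) (hessConst 4 4 δ C Cv Cw) (δ / 4) := by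
  have h := decay510_hessKer_explicit hGa hV hW hδ hn μ ν
  simpa [TOfRed, Fintype.card_fin] using h

/-- [folklore] **THE (1.22)-MOMENT OF `TOfRed` IS BOUNDED BY A FUNCTION OF THE DECAY DATA ONLY**:
`|secondMoment (TOfRed n a S W) μ ν| ≤ betaPrime510 4 (hessConst 4 4 δ C Cv Cw) (δ/4)` (`B12Sec2to5.secondMoment_abs_le_of_decay510`) — no
`log n` can come out of a family whose three decay data are `n`-free (the «UNIT»/«REST» mechanism of node A in kernel currency). -/
theorem abs_secondMoment_TOfRed_le (hn : 1 ≤ n) (hGa : Decays (Ga n a) C δ) (hV : VertexFamily (vertexRed n S) n Cv δ)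
    (hW : VertexFamily₂ W n Cw δ) (hδ : 0 < δ) (μ ν : Fin 4) :
    |B12Beta.secondMoment (TOfRed n a S W) μ ν| ≤ betaPrime510 4 (hessConst 4 4 δ C Cv Cw) (δ / 4) :=
  (secondMoment_abs_le_of_decay510 (P := TOfRed n a S W) (by positivity) (decay510_TOfRed n a hn hGa hV hW hδ μ ν)).2

/-- [folklore] … and the (1.22) integrand is summable. -/
theorem summable_secondMoment_TOfRed (hn : 1 ≤ n) (hGa : Decays (Ga n a) C δ) (hV : VertexFamily (vertexRed n S) n Cv δ)
    (hW : VertexFamily₂ W n Cw δ) (hδ : 0 < δ) (μ ν : Fin 4) :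
    Summable (fun x : Site 4 => TOfRed n a S W μ ν x * (x μ : ℝ) * (x ν : ℝ)) :=
  (secondMoment_abs_le_of_decay510 (P := TOfRed n a S W) (by positivity) (decay510_TOfRed n a hn hGa hV hW hδ μ ν)).1

/-- [folklore] `AbsMoment₂` of every channel (the `hTA`-type slot), rates matched by monotonicity: GIVEN `Decays (Ga n a) C δA` and vertex /
table families at ANY positive rates. -/
theorem absMoment₂_TOfRed (hn : 1 ≤ n) {δA δv δ2 : ℝ} (hGa : Decays (Ga n a) C δA) (hδA : 0 < δA)
    (hV : VertexFamily (vertexRed n S) n Cv δv) (hδv : 0 < δv) (hW : VertexFamily₂ W n Cw δ2) (hδ2 : 0 < δ2) (μ ν : Fin 4) :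
    AbsMoment₂ (TOfRed n a S W μ ν) := by
  have hC : 0 ≤ C := hGa.nonneg 0
  have hCv : 0 ≤ Cv := (hV μ 0).nonneg 0
  have hCw : 0 ≤ Cw := (hW μ 0 ν 0).nonneg 0
  set δ' : ℝ := min δA (min δv δ2) with hδ'
  have hδ'pos : 0 < δ' := lt_min hδA (lt_min hδv hδ2)
  have hA' : Decays (Ga n a) C δ' := decays_mono hGa hC le_rfl (min_le_left _ _)
  have hV' : VertexFamily (vertexRed n S) n Cv δ' := fun μ' y =>
    biLoc_mono (hV μ' y) hCv ((min_le_right _ _).trans (min_le_left _ _))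
  have hW' : VertexFamily₂ W n Cw δ' := fun μ' y ν' y' =>
    biLoc_mono (hW μ' y ν' y') hCw ((min_le_right _ _).trans (min_le_right _ _))
  exact absMoment₂_hessKer hA' hV' hW' hδ'pos hn μ ν

end Decay

end Summit.QuantumFields.BalabanUV.Beta.D1BFx.ReducedKernel

end
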